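import Literature.AlgebraicGeometry.Morphisms.CechUnitCocycleDualNumbers
import Literature.RingTheory.CompleteLocalRings.DualNumberPoints
import Mathlib.RingTheory.Ideal.Cotangent
import Mathlib.LinearAlgebra.Dual.Lemmas
import HarnessLib

/-!
# Derivations at an augmentation are the dual of the cotangent module; the cotangent module of `𝔪(O/𝔪^{N+1})`

Generic commutative algebra behind the dimension count of the M13 lift induction ([MumfordAV1970] §13; [GortzWedhorn2023]
Prop. 27.122): for an augmented `k`-algebra `ρ : B → k` the `k`-module `DerAt ρ` of derivations `B → k` at `ρ`
(`Morphisms/CechUnitCocycleKodairaSpencer`) is LINEARLY ISOMORPHIC to the dual of the cotangent module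
`(ker ρ)/(ker ρ)²` (`derAtEquivDual`, [GortzWedhorn2020] (6.4): `T_x X = (𝔪_x/𝔪_x²)^∨`; the tree's
★ `RingTheory.CompleteLocalRings.TangentHom.equivDual` is the same dictionary for `k[ε]`-points), hence
`dim DerAt ρ = dim (ker ρ)/(ker ρ)²` (`finrank_derAt_eq`); and for a local `k`-algebra `O` and `N ≥ 1` the cotangent
module of `ker ρ = 𝔪·(O/𝔪^{N+1})` IS `𝔪/𝔪²` (`cotangentMapQuotPow_bijective`, `finrank_cotangent_ker_eq`: Mathlib's
`Ideal.mapCotangent` along the quotient map is bijective because `𝔪^{N+1} ≤ 𝔪²`).  Theorems + three auxiliary linear maps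
(`DerAt.restrictKer`, `derAtToDual`, `dualToDerAtFun`) and the equivalence; no named fact.
HC_CM is proved only modulo the 7 printed citations until rung 0 closes.

## References
* [GortzWedhorn2020] U. Görtz, T. Wedhorn, *Algebraic Geometry I* (2nd ed. 2020), (6.4) and Prop. 6.7 (tangent space as `k[ε]`-points, `T_x = (𝔪_x/𝔪_x²)^∨`).
* [GortzWedhorn2023] U. Görtz, T. Wedhorn, *Algebraic Geometry II* (2023), Lemma 24.72 (proof, Step (I)), Prop. 27.20 (p. 611).
* [Mazur1997Deformation] B. Mazur, *An introduction to the deformation theory of Galois representations* (1997), §15.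
* [MumfordAV1970] D. Mumford, *Abelian Varieties* (1970), §13 (proof of the Thm. pp. 125–130).
-/

noncomputable section

universe u v

open TensorProduct CategoryTheory AlgebraicGeometry

namespace Literature.AlgebraicGeometry.Morphisms.CechUnitCocycle

open Literature.RingTheory.CompleteLocalRings IsLocalRing

section DerAtDual

variable {k : Type u} [Field k] {B : Type u} [CommRing B] [Algebra k B] (ρ : B →ₐ[k] k)

/-- The restriction of a derivation at `ρ` to the augmentation ideal `ker ρ`, as a `k`-linear map.
[cite: GortzWedhorn2020, (6.4) and Prop. 6.7] -/
def DerAt.restrictKer (D : DerAt ρ) : ↥(RingHom.ker ρ) →ₗ[k] k where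
  toFun x := (D : B →ₗ[k] k) x
  map_add' x y := by simp
  map_smul' c x := by simp

/-- Unfolding `restrictKer`. [cite: GortzWedhorn2020, (6.4) and Prop. 6.7] -/
@[simp] theorem DerAt.restrictKer_apply (D : DerAt ρ) (x : ↥(RingHom.ker ρ)) :
    DerAt.restrictKer ρ D x = (D : B →ₗ[k] k) x := rfl

/-- A derivation at `ρ` kills products of elements of `ker ρ`. [cite: GortzWedhorn2020, (6.4) and Prop. 6.7] -/
theorem DerAt.restrictKer_mul (D : DerAt ρ) (x y : ↥(RingHom.ker ρ)) : DerAt.restrictKer ρ D (x * y) = 0 := by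
  have hx : ρ (x : B) = 0 := x.2
  have hy : ρ (y : B) = 0 := y.2
  change (D : B →ₗ[k] k) ((x : B) * y) = 0
  rw [D.2 x y, hx, hy, zero_mul, zero_mul, add_zero]

/-- **Derivation ↦ linear form on `(ker ρ)/(ker ρ)²`.** [cite: GortzWedhorn2020, (6.4) and Prop. 6.7] -/
def derAtToDual : DerAt ρ →ₗ[k] Module.Dual k (RingHom.ker ρ).Cotangent where
  toFun D := Ideal.Cotangent.lift (DerAt.restrictKer ρ D) (DerAt.restrictKer_mul ρ D)
  map_add' D D' := by
    refine LinearMap.ext fun v => ?_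
    obtain ⟨x, rfl⟩ := (RingHom.ker ρ).toCotangent_surjective v
    simp only [Ideal.Cotangent.lift_toCotangent, DerAt.restrictKer_apply, Submodule.coe_add,
      LinearMap.add_apply]
  map_smul' c D := by
    refine LinearMap.ext fun v => ?_
    obtain ⟨x, rfl⟩ := (RingHom.ker ρ).toCotangent_surjective v
    simp only [Ideal.Cotangent.lift_toCotangent, DerAt.restrictKer_apply, Submodule.coe_smul,
      LinearMap.smul_apply, RingHom.id_apply]

/-- `derAtToDual D [x] = D x`. [cite: GortzWedhorn2020, (6.4) and Prop. 6.7] -/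
@[simp] theorem derAtToDual_toCotangent (D : DerAt ρ) (x : ↥(RingHom.ker ρ)) :
    derAtToDual ρ D ((RingHom.ker ρ).toCotangent x) = (D : B →ₗ[k] k) x := rfl

/-- **Linear form on `(ker ρ)/(ker ρ)²` ↦ derivation**: `b ↦ ℓ [b − ρ(b)]` (the `ε`-part of ★ `TangentHom.ofDual`).
[cite: GortzWedhorn2020, (6.4) and Prop. 6.7] [cite: Mazur1997Deformation, §15] -/
def dualToDerAtFun (ℓ : Module.Dual k (RingHom.ker ρ).Cotangent) : B →ₗ[k] k where
  toFun b := ℓ ((RingHom.ker ρ).toCotangent (TangentHom.proj ρ b))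
  map_add' b b' := by rw [map_add, map_add, map_add]
  map_smul' c b := by rw [map_smul, LinearMap.map_smul_of_tower, map_smul, RingHom.id_apply]

/-- Unfolding `dualToDerAtFun`. [cite: GortzWedhorn2020, (6.4) and Prop. 6.7] -/
@[simp] theorem dualToDerAtFun_apply (ℓ : Module.Dual k (RingHom.ker ρ).Cotangent) (b : B) :
    dualToDerAtFun ρ ℓ b = ℓ ((RingHom.ker ρ).toCotangent (TangentHom.proj ρ b)) := rfl

/-- `dualToDerAtFun ℓ` is a derivation at `ρ` (Leibniz: ★ `TangentHom.toCotangent_proj_mul`).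
[cite: GortzWedhorn2020, (6.4) and Prop. 6.7] -/
theorem dualToDerAtFun_mem (ℓ : Module.Dual k (RingHom.ker ρ).Cotangent) : dualToDerAtFun ρ ℓ ∈ DerAt ρ := by
  intro b b'
  simp only [dualToDerAtFun_apply, TangentHom.toCotangent_proj_mul, map_add, map_smul, smul_eq_mul]

/-- **`DerAt ρ ≃ₗ Dual ((ker ρ)/(ker ρ)²)`** — tangent vectors at the augmentation are the dual of the cotangent
module (Görtz–Wedhorn I (6.4): `T_x X = (𝔪_x/𝔪_x²)^∨`). [cite: GortzWedhorn2020, (6.4) and Prop. 6.7] [cite: Mazur1997Deformation, §15] -/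
def derAtEquivDual : DerAt ρ ≃ₗ[k] Module.Dual k (RingHom.ker ρ).Cotangent :=
  { derAtToDual ρ with
    invFun := fun ℓ => ⟨dualToDerAtFun ρ ℓ, dualToDerAtFun_mem ρ ℓ⟩
    left_inv := fun D => by
      refine Subtype.ext (LinearMap.ext fun b => ?_)
      change dualToDerAtFun ρ (derAtToDual ρ D) b = (D : B →ₗ[k] k) b
      rw [dualToDerAtFun_apply, derAtToDual_toCotangent, TangentHom.coe_proj, map_sub,
        DerAt.apply_algebraMap D.2, sub_zero]
    right_inv := fun ℓ => by
      refine LinearMap.ext fun v => ?_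
      obtain ⟨x, rfl⟩ := (RingHom.ker ρ).toCotangent_surjective v
      change derAtToDual ρ ⟨dualToDerAtFun ρ ℓ, _⟩ ((RingHom.ker ρ).toCotangent x) = _
      rw [derAtToDual_toCotangent]
      change dualToDerAtFun ρ ℓ x = _
      rw [dualToDerAtFun_apply, TangentHom.proj_of_mem] }

/-- `dim DerAt ρ = dim (ker ρ)/(ker ρ)²` and finite-dimensionality transfers. [cite: GortzWedhorn2020, (6.4) and Prop. 6.7] -/
theorem finrank_derAt_eq [FiniteDimensional k (RingHom.ker ρ).Cotangent] :
    FiniteDimensional k (DerAt ρ) ∧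
      Module.finrank k (DerAt ρ) = Module.finrank k (RingHom.ker ρ).Cotangent :=
  ⟨LinearEquiv.finiteDimensional (derAtEquivDual ρ).symm,
    ((derAtEquivDual ρ).finrank_eq).trans Subspace.dual_finrank_eq⟩

end DerAtDual

/-! ### (g9-2) The cotangent module of `𝔪 (O/𝔪^{N+1})` is `𝔪/𝔪²` for `N ≥ 1` (generic algebra) -/

section CotangentQuot

variable {k : Type u} [Field k] {O : Type u} [CommRing O] [IsLocalRing O] [Algebra k O] (N : ℕ)
  (ρ : (O ⧸ maximalIdeal O ^ (N + 1)) →ₐ[k] k)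
  (hρ : RingHom.ker ρ = (maximalIdeal O).map (Ideal.Quotient.mk (maximalIdeal O ^ (N + 1))))

include hρ in
/-- `𝔪 ≤ mk⁻¹(ker ρ)` when `ker ρ = 𝔪 (O/𝔪^{N+1})`. [cite: GortzWedhorn2020, (6.4) and Prop. 6.7] -/
theorem maximalIdeal_le_comap_ker :
    maximalIdeal O ≤ (RingHom.ker ρ).comap (Ideal.Quotient.mkₐ k (maximalIdeal O ^ (N + 1))) :=
  fun x hx => by
    rw [Ideal.mem_comap, hρ]
    exact Ideal.mem_map_of_mem _ hx

/-- **`𝔪/𝔪² → (ker ρ)/(ker ρ)²` along `O → O/𝔪^{N+1}` is bijective for `N ≥ 1`** (`𝔪^{N+1} ≤ 𝔪²`).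
[cite: GortzWedhorn2023, Lemma 24.72 (proof, Step (I), p. 410)] -/
theorem cotangentMapQuotPow_bijective (hN : 1 ≤ N) :
    Function.Bijective (Ideal.mapCotangent (maximalIdeal O) (RingHom.ker ρ)
      (Ideal.Quotient.mkₐ k (maximalIdeal O ^ (N + 1))) (maximalIdeal_le_comap_ker N ρ hρ)) := by
  have hpow : maximalIdeal O ^ (N + 1) ≤ maximalIdeal O ^ 2 := Ideal.pow_le_pow_right (by omega)
  constructor
  · rw [injective_iff_map_eq_zero]
    intro v hv
    obtain ⟨x, rfl⟩ := (maximalIdeal O).toCotangent_surjective v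
    rw [Ideal.mapCotangent_toCotangent] at hv
    have h1 : Ideal.Quotient.mk (maximalIdeal O ^ (N + 1)) (x : O) ∈ RingHom.ker ρ ^ 2 :=
      (Ideal.toCotangent_eq_zero _ _).1 hv
    rw [hρ, ← Ideal.map_pow, Ideal.mem_map_iff_of_surjective _ Ideal.Quotient.mk_surjective] at h1
    obtain ⟨z, hz, hzx⟩ := h1
    rw [Ideal.Quotient.eq] at hzx
    rw [Ideal.toCotangent_eq_zero]
    have : (x : O) = z - (z - x) := by ring
    rw [this]
    exact sub_mem hz (hpow hzx)
  · intro w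
    obtain ⟨y, rfl⟩ := (RingHom.ker ρ).toCotangent_surjective w
    have hy : (y : O ⧸ maximalIdeal O ^ (N + 1)) ∈ (maximalIdeal O).map (Ideal.Quotient.mk _) := hρ ▸ y.2
    rw [Ideal.mem_map_iff_of_surjective _ Ideal.Quotient.mk_surjective] at hy
    obtain ⟨x, hx, hxy⟩ := hy
    refine ⟨(maximalIdeal O).toCotangent ⟨x, hx⟩, ?_⟩
    rw [Ideal.mapCotangent_toCotangent]
    congr 1
    exact Subtype.ext hxy

include hρ in
/-- The resulting linear isomorphism `(ker ρ)/(ker ρ)² ≃ₗ 𝔪/𝔪²` (inverse of `Ideal.mapCotangent`), its finrank and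
finiteness consequences. [cite: GortzWedhorn2023, Lemma 24.72 (proof, Step (I), p. 410)] -/
theorem finrank_cotangent_ker_eq (hN : 1 ≤ N) [FiniteDimensional k (maximalIdeal O).Cotangent] :
    FiniteDimensional k (RingHom.ker ρ).Cotangent ∧
      Module.finrank k (RingHom.ker ρ).Cotangent = Module.finrank k (maximalIdeal O).Cotangent := by
  let e := LinearEquiv.ofBijective _ (cotangentMapQuotPow_bijective N ρ hρ hN)
  exact ⟨LinearEquiv.finiteDimensional e, e.finrank_eq.symm⟩

end CotangentQuot

end Literature.AlgebraicGeometry.Morphisms.CechUnitCocycle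

end
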